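import Literature.NumberTheory.Automorphic.BianchiCohomologyFinite
import Literature.Algebra.Homology.GroupCohomologyGoodCoverFiniteType
import HarnessLib

/-!
# The good translate cover of the Hermitian cone for `GL₂(𝓞_K)`, `K` imaginary quadratic, and the
# finite-type property of the cohomology of Bianchi groups over every coefficient ring

Topic `NumberTheory/Automorphic`; namespace `Literature.NumberTheory.Automorphic`, grouping
sub-namespace `BianchiCusp`.  Theorems only: no definition, no named fact, no `sorry`.

`BianchiCohomologyFinite.finite_groupCohomology_gl2` feeds the data of the cover of the cone `𝒫`
of positive definite binary Hermitian forms by the `GL₂(𝓞_K)`-translates of finitely many convex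
open prototypes (thick boxes and cusp boxes: `exists_thick_finset`, `exists_act_mem_cuspBox`,
`finite_thick_thick`, …) into the finiteness form of Brown's criterion.  Here the SAME data (the
proof is that of `finite_groupCohomology_gl2` verbatim up to its last step) is packaged as a
`GoodTranslateCover (GL (Fin 2) (𝓞 K))` (`nonempty_goodTranslateCover_gl2`), so that the
FINITE-TYPE form of the criterion (`isCohFiniteTypeUpTo_one_of_goodTranslateCover`,
`Literature/Algebra/Homology/GroupCohomologyGoodCoverFiniteType`) applies:

* `isCohFiniteTypeUpTo_gl2` — for EVERY commutative ring `k`, `Hⁿ(GL₂(𝓞_K), -)` is of finite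
  type over `k`: finitely generated on finitely generated coefficients (`k` Noetherian) and
  commuting with directed unions of subrepresentations — the consequences of Borel–Serre's
  "arithmetic groups are of type (WFL)" ([BorelSerre1973, §11.1], [Serre1971CohomologieGroupesDiscrets,
  §2.4]) that the integral comparison of [Scholze2015, §V.4] uses;
* `isCohFiniteTypeUpTo_glIntegersRange` — the same for the image of `GL₂(𝓞_K)` in `GL₂(K)`;
* `isCohFiniteTypeUpTo_congruenceSubgroup_gl2` — for a compact open `U ≤ GL₂(𝔸_K^∞)` the
  congruence subgroup `Γ_U = GL₂(K) ∩ U` is of finite type up to the index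
  `[Γ_U : Γ_U ∩ GL₂(𝓞_K)]` (commensurability, `IsCohFiniteTypeUpTo.of_commensurable`).

## References

* A. Borel, J.-P. Serre, *Corners and arithmetic groups*, Comment. Math. Helv. 48 (1973), §11
  [BorelSerre1973].
* J. Elstrodt, F. Grunewald, J. Mennicke, *Groups Acting on Hyperbolic Space* (1998), Ch. 7 §7.3
  [ElstrodtGrunewaldMennicke1998].
* K. S. Brown, *Cohomology of Groups* (1982), VII (7.10), VIII (4.6), (4.8)
  [Brown1982CohomologyGroups].
* P. Scholze, Ann. of Math. 182 (2015), §V.4 [Scholze2015].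
-/

noncomputable section

open Matrix Complex NumberField CategoryTheory
open scoped MatrixGroups ComplexConjugate Pointwise

namespace Literature.NumberTheory.Automorphic

namespace BianchiCusp

open BianchiCone Literature.NumberTheory.NumberFields Literature.Algebra.Homology
open Literature.AlgebraicTopology.SingularHomology

section FiniteType

variable {K : Type} [Field K] [NumberField K]

/-- **The good translate cover of the Hermitian cone for `GL₂(𝓞_K)`**, `K` imaginary quadratic:
`GL₂(𝓞_K)` acts (through a complex embedding) continuously on the contractible cone of positive
definite binary Hermitian forms, which is covered by the translates of finitely many convex open
prototypes with pairwise local finiteness and contractible finite intersections — the data of the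
proof of `finite_groupCohomology_gl2`, bundled. [cite: ElstrodtGrunewaldMennicke1998, Ch. 7 §7.3]
[cite: BorelSerre1973, §11] -/
theorem nonempty_goodTranslateCover_gl2 [IsTotallyComplex K] (hK : Module.finrank ℚ K = 2) :
    Nonempty (GoodTranslateCover (GL (Fin 2) (𝓞 K))) := by
  classical
  obtain ⟨σ⟩ := nonempty_ringHom_complex hK
  -- the action of `Γ` on the cone through `σ`
  letI : MulAction (GL (Fin 2) (𝓞 K)) ↥cone := MulAction.compHom ↥cone (toGL σ)
  haveI : ContinuousConstSMul (GL (Fin 2) (𝓞 K)) ↥cone := ⟨fun γ => continuous_const_smul (toGL σ γ)⟩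
  have coe_gsmul : ∀ (γ : GL (Fin 2) (𝓞 K)) (x : ↥cone), ((γ • x : ↥cone) : Mat) = act (toGL σ γ) x :=
    fun _ _ => rfl
  -- the data
  obtain ⟨t, ε, hε, hthick⟩ := exists_thick_finset σ hK
  obtain ⟨T, hT0, hT1, hT⟩ := exists_inequivalent_representatives (K := K)
  obtain ⟨ω, hω⟩ := ImaginaryQuadratic.exists_im_ne_zero (K := K) σ
  set δ : ℝ := (1 + ‖σ (ω : K)‖) / 2 + 1 with hδ
  have hδ' : (1 + ‖σ (ω : K)‖) / 2 < δ := by rw [hδ]; linarith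
  -- prototypes (as subsets of `M₂(ℂ)` contained in the cone) and the cover pieces
  let P : ↥t ⊕ ↥T → Set Mat := Sum.elim
    (fun j => cone ∩ coneOver (thickBox (coords (j.1 : Mat)) (ε j.1)))
    (fun u => cuspBox σ (hT0 u.1 u.2) δ)
  let V : ↥t ⊕ ↥T → Set ↥cone := fun b => {x | (x : Mat) ∈ P b}
  have hPcone : ∀ b, P b ⊆ cone := by
    rintro (j | u)
    · exact Set.inter_subset_left
    · exact fun H hH => hH.1
  have hPconv : ∀ b, Convex ℝ (P b) := by
    rintro (j | u)
    · exact convex_cone.inter (convex_coneOver (convex_thickBox _ _))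
    · exact convex_cuspBox σ _ δ
  have hV : ∀ b, IsOpen (V b) := by
    rintro (j | u)
    · have : V (Sum.inl j) = {x : ↥cone | (x : Mat) ∈ coneOver (thickBox (coords (j.1 : Mat)) (ε j.1))} := by
        ext x
        exact ⟨fun h => h.2, fun h => ⟨x.2, h⟩⟩
      rw [this]
      exact isOpen_coe_preimage_coneOver (isOpen_thickBox _ _)
    · exact isOpen_coe_preimage_cuspBox σ _ δ
  have hsmul : ∀ (γ : GL (Fin 2) (𝓞 K)) (b : ↥t ⊕ ↥T) (x : ↥cone),
      x ∈ γ • V b ↔ act (toGL σ γ⁻¹) (x : Mat) ∈ P b := by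
    intro γ b x
    rw [Set.mem_smul_set_iff_inv_smul_mem]
    rfl
  have hsmul' : ∀ (γ : GL (Fin 2) (𝓞 K)) (b : ↥t ⊕ ↥T),
      γ • V b = {x : ↥cone | (x : Mat) ∈ act (toGL σ γ) '' P b} := by
    intro γ b
    ext x
    rw [hsmul]
    constructor
    · intro h
      exact ⟨_, h, by rw [map_inv, ← act_mul, mul_inv_cancel, act_one]⟩
    · rintro ⟨M, hM, hMx⟩
      rw [← hMx, map_inv, ← act_mul, inv_mul_cancel, act_one]
      exact hM
  refine ⟨GoodTranslateCover.mk (↥cone) (↥t ⊕ ↥T) V hV ?_ ?_ ?_⟩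
  · -- the translates cover
    intro x
    by_cases h : ∃ v : OVec K, v ≠ 0 ∧ depth σ v (x : Mat) < 1
    · obtain ⟨v, hv, hd⟩ := h
      obtain ⟨γ, u, huT, hmem⟩ := exists_act_mem_cuspBox σ hK hT0 hT hω hδ' x.2 hv hd
      refine ⟨γ⁻¹, Sum.inr ⟨u, huT⟩, (hsmul _ _ _).2 ?_⟩
      rw [inv_inv]
      exact hmem
    · push Not at h
      obtain ⟨γ, j, hj, hmem⟩ := hthick x x.2 h
      refine ⟨γ⁻¹, Sum.inl ⟨j, hj⟩, (hsmul _ _ _).2 ?_⟩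
      rw [inv_inv]
      exact ⟨act_mem_cone _ x.2, hmem⟩
  · -- finite intersections of translates are contractible
    intro p J hne
    have hEq : cechSet (translCover (S := GL (Fin 2) (𝓞 K)) V) J =
        {x : ↥cone | (x : Mat) ∈ ⋂ k, act (toGL σ (J k).g) '' P (J k).b} := by
      ext x
      simp only [mem_cechSet_iff, translCover_apply, hsmul', Set.mem_setOf_eq, Set.mem_iInter]
    rw [hEq] at hne ⊢
    obtain ⟨x, hx⟩ := hne
    refine contractibleSpace_coe_preimage (convex_iInter fun k => convex_image_act _ (hPconv _)) ?_ ⟨_, hx⟩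
    intro M hM
    obtain ⟨N, hN, rfl⟩ := Set.mem_iInter.1 hM 0
    exact act_mem_cone _ (hPcone _ hN)
  · -- local finiteness
    intro b b'
    have hsub : {γ : GL (Fin 2) (𝓞 K) | (γ • V b ∩ V b').Nonempty} ⊆
        {γ | ∃ H ∈ cone, act (toGL σ γ⁻¹) H ∈ P b ∧ H ∈ P b'} := by
      rintro γ ⟨x, hx, hx'⟩
      exact ⟨x, x.2, (hsmul γ b x).1 hx, hx'⟩
    refine Set.Finite.subset ?_ hsub
    rcases b with j | u <;> rcases b' with j' | u'
    · refine (finite_thick_thick σ hK (hε j.1).1 (hε j.1).2.1 (hε j.1).2.2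
        (hε j'.1).1 (hε j'.1).2.1 (hε j'.1).2.2).subset ?_
      rintro γ ⟨H, hH, ⟨-, h1⟩, ⟨-, h2⟩⟩
      exact ⟨H, hH, h1, h2⟩
    · refine (finite_thick_cusp σ hK (hε j.1).1 (hε j.1).2.1 (hε j.1).2.2 (hT0 u'.1 u'.2) δ).subset ?_
      rintro γ ⟨H, hH, ⟨-, h1⟩, h2⟩
      exact ⟨H, hH, h1, h2⟩
    · refine (finite_cusp_thick σ hK (hT0 u.1 u.2) δ (hε j'.1).1 (hε j'.1).2.1 (hε j'.1).2.2).subset ?_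
      rintro γ ⟨H, hH, h1, ⟨-, h2⟩⟩
      exact ⟨H, hH, h1, h2⟩
    · by_cases huu : (u : OVec K) = u'
      · obtain rfl : u = u' := Subtype.ext huu
        exact finite_cusp_cusp σ hK (hT0 u.1 u.2) δ
      · convert Set.finite_empty
        ext γ
        simp only [Set.mem_setOf_eq, Set.mem_empty_iff_false, iff_false]
        rintro ⟨H, -, h1, h2⟩
        exact huu (hT1 _ u.2 _ u'.2 (cuspRel_of_mem_cuspBox σ hK (hT0 u.1 u.2) (hT0 u'.1 u'.2) h1 h2))


/-- **The cohomology of `GL₂(𝓞_K)` is of finite type over every commutative ring**, `K` imaginary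
quadratic: `Hⁿ(GL₂(𝓞_K), A)` is finitely generated for `A` finitely generated over Noetherian `k`,
and `Hⁿ(GL₂(𝓞_K), -)` commutes with directed unions of subrepresentations.
[cite: BorelSerre1973, §11.1] [cite: Brown1982CohomologyGroups, VII (7.10), VIII (4.6)] -/
theorem isCohFiniteTypeUpTo_gl2 [IsTotallyComplex K] (hK : Module.finrank ℚ K = 2) (k : Type)
    [CommRing k] : IsCohFiniteTypeUpTo k (GL (Fin 2) (𝓞 K)) 1 := by
  obtain ⟨W⟩ := nonempty_goodTranslateCover_gl2 (K := K) hK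
  exact isCohFiniteTypeUpTo_one_of_goodTranslateCover W k

/-- The same for the image of `GL₂(𝓞_K)` in `GL₂(K)`. [cite: BorelSerre1973, §11.1] -/
theorem isCohFiniteTypeUpTo_glIntegersRange [IsTotallyComplex K] (hK : Module.finrank ℚ K = 2)
    (k : Type) [CommRing k] :
    IsCohFiniteTypeUpTo k (Matrix.GeneralLinearGroup.map (algebraMap (𝓞 K) K) :
      GL (Fin 2) (𝓞 K) →* GL (Fin 2) K).range 1 :=
  (isCohFiniteTypeUpTo_gl2 hK k).of_mulEquiv
    (MonoidHom.ofInjective (BigHeckeGLn.map_algebraMap_ringOfIntegers_injective 2 K))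

/-- **Congruence subgroups of `GL₂` over an imaginary quadratic field have cohomology of finite
type** up to the index `[Γ_U : Γ_U ∩ GL₂(𝓞_K)]`: for `U ≤ GL₂(𝔸_K^∞)` compact open and
`Γ_U = GL₂(K) ∩ U`. [cite: BorelSerre1973, §11.1, 11.6] [cite: Brown1982CohomologyGroups, VIII (5.1)] -/
theorem isCohFiniteTypeUpTo_congruenceSubgroup_gl2 [IsTotallyComplex K] (hK : Module.finrank ℚ K = 2)
    (k : Type) [CommRing k] (U : Subgroup (BigHeckeGLn.FiniteAdelicGL 2 K))
    (hUo : IsOpen (U : Set (BigHeckeGLn.FiniteAdelicGL 2 K)))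
    (hUc : IsCompact (U : Set (BigHeckeGLn.FiniteAdelicGL 2 K))) :
    ∃ m : ℕ, m ≠ 0 ∧ IsCohFiniteTypeUpTo k (U.comap (BigHeckeGLn.globalEmbedding 2 K)) m := by
  have hc := BigHeckeGLn.commensurable_comap_globalEmbedding_glIntegers U hUo hUc
  haveI : ((U.comap (BigHeckeGLn.globalEmbedding 2 K)).subgroupOf (Matrix.GeneralLinearGroup.map
      (algebraMap (𝓞 K) K) : GL (Fin 2) (𝓞 K) →* GL (Fin 2) K).range).FiniteIndex := ⟨hc.1⟩
  haveI hfi : ((Matrix.GeneralLinearGroup.map (algebraMap (𝓞 K) K) :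
      GL (Fin 2) (𝓞 K) →* GL (Fin 2) K).range.subgroupOf
        (U.comap (BigHeckeGLn.globalEmbedding 2 K))).FiniteIndex := ⟨hc.2⟩
  refine ⟨1 * ((Matrix.GeneralLinearGroup.map (algebraMap (𝓞 K) K) :
      GL (Fin 2) (𝓞 K) →* GL (Fin 2) K).range.subgroupOf (U.comap (BigHeckeGLn.globalEmbedding 2 K))).index,
    by rw [one_mul]; exact hfi.index_ne_zero, ?_⟩
  exact (isCohFiniteTypeUpTo_glIntegersRange hK k).of_commensurable _ _

end FiniteType

end BianchiCusp

end Literature.NumberTheory.Automorphic
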